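import Literature.AlgebraicGeometry.HodgeTheory.GAGAJunkGraphChowAnalytic
import Literature.AlgebraicGeometry.HodgeTheory.GAGARegularOfUnitTimesRational
import HarnessLib

/-!
# GAGA: a meromorphic function with HOLOMORPHIC NUMERATOR and algebraic poles is a regular function

J.-P. Serre, *Géométrie algébrique et géométrie analytique*, Ann. Inst. Fourier 6 (1956), n° 19 Prop. 13
(théorème de Chow) and n° 19 Prop. 15 («toute application holomorphe d'une variété algébrique compacte
dans une variété algébrique est régulière»); D. Mumford, *Algebraic Geometry I* (1981), §4B (4.14). The
tree's files `GAGAJunkGraphChow` / `GAGARegularOfUnitTimesRational` run Serre's road for functions locally of the form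
`g · b(φ ·) = u · a(φ ·)` (`u` a holomorphic UNIT: zeros AND poles algebraically controlled — the shape met in
GAGA-injectivity on `Pic`). This file runs the SAME road for the local form with a HOLOMORPHIC NUMERATOR,
`g · b(φ ·) = P` with `P` holomorphic and `T ∩ W = D(b)` (poles algebraically controlled, zeros arbitrary) — the
shape met in GAGA-injectivity on `H¹(𝒪)`: if an algebraic Čech 1-cocycle `(f_ij)` of `𝒪_X` is a HOLOMORPHIC
coboundary `f_ij = h_i − h_j`, then near a point of `U_j` the function `h_i = h_j + a/b^N` has holomorphic
numerator `h_j b^N + a` and algebraic denominator `b^N` (consumer: cell hodgecm-mathlib, U-a3 road M13 node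
(3e) `finrank ℂ Ȟ¹(𝔘, 𝒪_{A₀}) ≤ g`, B-plan1 (g11) P46/P47 road (μ)). To maximise reuse, the Chow and
closed-graph halves are stated for an ARBITRARY function whose junk graph is analytic:

* (in `GAGAJunkGraphChowAnalytic`: `isAnalyticSet_junkGraph_of_holNumerator`, `exists_isClosed_junkGraph_of_isAnalyticSet`);
* `exists_hom_openOver_projectiveSpace_of_isAnalyticSet_junkGraph`,
  `exists_section_eval_eq_of_isAnalyticSet_junkGraph` — over the open subscheme `T` (normal) an analytic junk
  graph is the graph of a morphism `T ⟶ ℙ¹` through `D₊(x₀)`, i.e. `g` is a REGULAR function on `T` (proofs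
  verbatim `GAGARegularOfUnitTimesRational`);
* `exists_section_eval_eq_of_holNumerator`, `exists_section_eval_eq_of_mdifferentiableOn_of_holNumerator` —
  the regularity statement for the holomorphic-numerator form (the second with the local form required only
  at the points of `X ∖ T`).

* `exists_section_eval_eq_of_sub_eq_eval` — APPLICATION (cocycle-level GAGA-injectivity on `H¹(𝒪)`): for a
  cover `U` whose complements are locally cut out by one equation, an algebraic Čech 1-cocycle of `𝒪_X` that
  is a HOLOMORPHIC coboundary `(h_i)` is an algebraic coboundary — each `h_i` is a regular `c_i ∈ Γ(X, U_i)`.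

Everything here is proved; no definitions, no named facts.

## References

* [SerreGAGA1956] J.-P. Serre, Géométrie algébrique et géométrie analytique, Ann. Inst. Fourier 6
  (1956), n° 12 Théorème 1 (p. 19), n° 19 Prop. 13–15 (pp. 29–30).
* [Mumford1981] D. Mumford, Algebraic Geometry I: Complex Projective Varieties (1981), §4B (4.14),
  p. 67.
* [MumfordAV1970] D. Mumford, Abelian Varieties (1970), §4 (closed graphs over normal varieties).
-/

noncomputable section

open scoped Manifold ContDiff Topology LinearAlgebra.Projectivization
open CategoryTheory AlgebraicGeometry MonoidalCategory Set
open Literature.AlgebraicGeometry.Motives (AlgPoints ComplexPoints SchemeOver IsSmoothProjective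
  projectiveSpace)
open Literature.AlgebraicGeometry.Motives.AlgPoints (evalOrZero)
open Literature.AlgebraicGeometry.Motives.OpenGraph (openOver openOverι)
open Literature.Geometry.Kaehler (IsAnalyticSet IsAnalyticSetAt)
open Literature.NumberTheory.Transcendental

namespace Literature.AlgebraicGeometry.HodgeTheory

universe u

section Main

variable {n : ℕ} {X : SchemeOver ℂ}
  {E : Type*} [NormedAddCommGroup E] [NormedSpace ℂ E] [FiniteDimensional ℂ E]
  {M : Type*} [TopologicalSpace M] [ChartedSpace E M] [IsManifold 𝓘(ℂ, E) ω M]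
  {φ : M → ComplexPoints X}

/-! ### Regularity over `T` for an analytic junk graph (the tree's closed-graph road, analyticity as hypothesis) -/
/-- **An analytic junk graph over `T` is the graph of a morphism `T ⟶ ℙ¹` through `D₊(x₀)`.** With
`X`, `φ`, `T`, `g`, `hS` as in `exists_isClosed_junkGraph_of_isAnalyticSet` and `T` non-empty: there is a morphism
`ψ : T ⟶ ℙ¹_ℂ` from the open subscheme `T ⊆ X` (over `ℂ`) which on complex points is `x ↦ [1 : g(φ⁻¹ x)]`.
Proof VERBATIM that of `GAGARegularOfUnitTimesRational.exists_hom_openOver_projectiveSpace_of_locally_unit_mul_div`: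
restrict the Zariski-closed junk graph `Z ⊆ X ×_ℂ ℙ¹` to `T ×_ℂ ℙ¹`, where its `ℂ`-points are exactly the pairs
`(x, [1 : g(φ⁻¹ x)])`, and apply the closed-graph principle over the normal variety `T` (Zariski's Main Theorem,
`Motives.exists_hom_forall_comp_eq_of_isClosed`). [cite: Mumford1981, §4B (4.14), p. 67] [cite: MumfordAV1970, §4] -/

theorem exists_hom_openOver_projectiveSpace_of_isAnalyticSet_junkGraph (hX : IsSmoothProjective n X)
    (hφ : IsAnalytification E X n φ) (T : X.left.Opens) (hT : (T : Set X.left).Nonempty) (g : M → ℂ)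
    (hS : IsAnalyticSet (𝓘(ℂ, E).prod 𝓘(ℂ, Fin 1 → ℂ))
      {p : M × ℙ ℂ (Fin 2 → ℂ) | (φ p.1).pt ∈ T → p.2 = Projectivization.mk ℂ ![1, g p.1] (by simp)}) :
    ∃ ψ : openOver X T ⟶ projectiveSpace 1 ℂ, ∀ x : ComplexPoints (openOver X T),
      AlgPoints.map ψ x = AlgPoints.map (chartι 1 0)
        (chartPoint 1 ![1, g (hφ.homeomorph.symm (AlgPoints.map (openOverι X T) x))]
          (by simp)) := by
  classical
  haveI : IsIntegral X.left := IsSmoothProjective.isIntegral_holds hX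
  haveI : SmoothOfRelativeDimension n X.hom := hX.smoothOfRelativeDimension
  haveI : Smooth X.hom := SmoothOfRelativeDimension.smooth n X.hom
  haveI : LocallyOfFiniteType X.hom := inferInstance
  -- the open subscheme `T` as a `ℂ`-scheme: integral, locally of finite type, normal
  haveI : Nonempty (T : Scheme) := by
    obtain ⟨x, hx⟩ := hT
    exact ⟨⟨x, hx⟩⟩
  haveI : IsIntegral (T : Scheme) := isIntegral_of_isOpenImmersion T.ι
  haveI : IsIntegral (openOver X T).left := this
  haveI : LocallyOfFiniteType (openOver X T).hom := by
    change LocallyOfFiniteType (T.ι ≫ X.hom)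
    infer_instance
  have hTn : ∀ t : (openOver X T).left, IsIntegrallyClosed ((openOver X T).left.presheaf.stalk t) := by
    intro t
    haveI := Literature.AlgebraicGeometry.Motives.isIntegrallyClosed_stalk_of_isSmoothProjective hX t.1
    exact IsIntegrallyClosed.of_equiv (T.stalkIso t).symm.commRingCatIsoToRingEquiv
  haveI : IsProper (projectiveSpace 1 ℂ).hom := inferInstance
  -- the Zariski-closed junk graph and its restriction to `T ×_ℂ ℙ¹`
  obtain ⟨Z, hZc, hZ⟩ := exists_isClosed_junkGraph_of_isAnalyticSet hX hφ T g hS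
  set ι := openOverι X T with hι
  set Γ' : Set ↥(openOver X T ⊗ projectiveSpace 1 ℂ).left :=
    (ι ▷ projectiveSpace 1 ℂ).left.base ⁻¹' Z with hΓ'
  have hΓ'c : IsClosed Γ' := hZc.preimage (ι ▷ projectiveSpace 1 ℂ).left.base.hom.continuous
  -- the map on complex points
  obtain ⟨φ₀, hφ₀⟩ : ∃ φ₀ : AlgPoints (openOver X T) ℂ → AlgPoints (projectiveSpace 1 ℂ) ℂ,
      φ₀ = fun x ↦ AlgPoints.map (chartι 1 0)
        (chartPoint 1 ![1, g (hφ.homeomorph.symm (AlgPoints.map ι x))] (by simp)) := ⟨_, rfl⟩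
  have hφ₀' : ∀ x, φ₀ x = projPoint 1
      (Projectivization.mk ℂ ![1, g (hφ.homeomorph.symm (AlgPoints.map ι x))] (by simp)) := by
    intro x
    rw [hφ₀]
    exact (projPoint_mk_eq_map_chartPoint (n := 1) (i := 0) _ (by simp)).symm
  -- the points of `T` map into `T`
  have hιT : ∀ x : AlgPoints (openOver X T) ℂ, (AlgPoints.map ι x).pt ∈ T := by
    intro x
    rw [AlgPoints.pt_map, hι, Literature.AlgebraicGeometry.Motives.OpenGraph.openOverι_left]
    exact (x.pt).2
  have key : ∀ (x : AlgPoints (openOver X T) ℂ) (y : AlgPoints (projectiveSpace 1 ℂ) ℂ),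
      AlgPoints.pt (CartesianMonoidalCategory.lift x y : AlgPoints (openOver X T ⊗ projectiveSpace 1 ℂ) ℂ)
        ∈ Γ' ↔ y = φ₀ x := by
    intro x y
    have h1 : AlgPoints.pt (CartesianMonoidalCategory.lift x y :
        AlgPoints (openOver X T ⊗ projectiveSpace 1 ℂ) ℂ) ∈ Γ' ↔
        AlgPoints.pt (AlgPoints.map (ι ▷ projectiveSpace 1 ℂ) (CartesianMonoidalCategory.lift x y)) ∈ Z := by
      rw [AlgPoints.pt_map]
      rfl
    rw [h1, AlgPoints.map_apply, CartesianMonoidalCategory.lift_whiskerRight, ← AlgPoints.map_apply ι x,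
      hZ (AlgPoints.map ι x) y, hφ₀']
    exact ⟨fun h ↦ h (hιT x), fun h _ ↦ h⟩
  obtain ⟨ψ, hψ⟩ := Literature.AlgebraicGeometry.Motives.exists_hom_forall_comp_eq_of_isClosed
    (T := openOver X T) (P := projectiveSpace 1 ℂ) hTn Γ' hΓ'c φ₀ key
  refine ⟨ψ, fun x ↦ ?_⟩
  rw [AlgPoints.map_apply, hψ x, hφ₀]

/-- **A function over `T` with analytic junk graph is regular.** Let `X` be smooth projective over `ℂ` with
analytification `φ : M → X(ℂ)` (holomorphic atlas), `T ⊆ X` open, and `g : M → ℂ` whose junk graph over `T` is an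
analytic subset of `M × ℙ¹(ℂ)`. Then `g` is the analytification of a REGULAR function on `T`: there is
`c ∈ Γ(X, T)` with `c(φ m) = g m` for all `m` with `φ m ∈ T(ℂ)`. Proof VERBATIM that of
`GAGARegularOfUnitTimesRational.exists_section_eval_eq_of_locally_unit_mul_div`: the morphism `T ⟶ ℙ¹_ℂ` of
`exists_hom_openOver_projectiveSpace_of_isAnalyticSet_junkGraph` has image in `D₊(x₀)` (all its complex points do;
Jacobson), so it lifts to `T ⟶ Spec ℂ[x₀, x₁]_{(x₀)}`; pull back the coordinate `x₁/x₀`. This is Serre's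
Prop. 15 (holomorphe ⇒ régulière). [cite: SerreGAGA1956, n° 19 Prop. 15 (pp. 29–30)] [cite: Mumford1981, §4B (4.14), p. 67] -/

theorem exists_section_eval_eq_of_isAnalyticSet_junkGraph (hX : IsSmoothProjective n X)
    (hφ : IsAnalytification E X n φ) (T : X.left.Opens) (g : M → ℂ)
    (hS : IsAnalyticSet (𝓘(ℂ, E).prod 𝓘(ℂ, Fin 1 → ℂ))
      {p : M × ℙ ℂ (Fin 2 → ℂ) | (φ p.1).pt ∈ T → p.2 = Projectivization.mk ℂ ![1, g p.1] (by simp)}) :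
    ∃ c : Γ(X.left, T), ∀ m : M, (φ m).pt ∈ T → evalOrZero T c (φ m) = g m := by
  classical
  by_cases hT : (T : Set X.left).Nonempty
  swap
  · exact ⟨0, fun m hm ↦ (hT ⟨(φ m).pt, hm⟩).elim⟩
  haveI : IsIntegral X.left := IsSmoothProjective.isIntegral_holds hX
  haveI : SmoothOfRelativeDimension n X.hom := hX.smoothOfRelativeDimension
  haveI : Smooth X.hom := SmoothOfRelativeDimension.smooth n X.hom
  haveI : LocallyOfFiniteType X.hom := inferInstance
  haveI : LocallyOfFiniteType (openOver X T).hom := by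
    change LocallyOfFiniteType (T.ι ≫ X.hom)
    infer_instance
  obtain ⟨ψ, hψ⟩ := exists_hom_openOver_projectiveSpace_of_isAnalyticSet_junkGraph hX hφ T hT g hS
  set ι := openOverι X T with hι
  haveI : IsOpenImmersion ι.left := by
    rw [hι]
    change IsOpenImmersion T.ι
    infer_instance
  -- `ψ` lands in the chart `D₊(x₀)`: all its complex points do (Jacobson)
  have hrange : Set.range ψ.left.base ⊆ Set.range (chartι 1 0).left.base := by
    refine Literature.AlgebraicGeometry.Motives.range_subset_of_isLocallyClosed_of_forall_pt_mem
      (T := openOver X T) ψ.left (chartι 1 0).left.isOpenEmbedding.isOpen_range.isLocallyClosed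
      fun x ↦ ?_
    have h1 : ψ.left.base x.pt = (AlgPoints.map ψ x).pt := (AlgPoints.pt_map ψ x).symm
    rw [h1, hψ x, AlgPoints.pt_map]
    exact ⟨_, rfl⟩
  -- lift `ψ` through the open immersion `D₊(x₀) = Spec ℂ[x₀, x₁]_{(x₀)} ⟶ ℙ¹`
  set ψ₀ : (openOver X T).left ⟶ (chartScheme 1 0).left :=
    IsOpenImmersion.lift (chartι 1 0).left ψ.left hrange with hψ₀
  have hψ₀fac : ψ₀ ≫ (chartι 1 0).left = ψ.left := IsOpenImmersion.lift_fac _ _ _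
  set ψ' : openOver X T ⟶ chartScheme 1 0 := Over.homMk ψ₀ (by
    rw [← Over.w (chartι 1 0), ← Category.assoc, hψ₀fac]
    exact Over.w ψ) with hψ'
  have hψ'ι : ψ' ≫ chartι 1 0 = ψ := by
    ext : 1
    simp only [hψ', Over.comp_left, Over.homMk_left]
    exact hψ₀fac
  -- the complex points of `T` map to the chart points with coordinates `(1, g(φ⁻¹ x))`
  have hψ'pt : ∀ x : ComplexPoints (openOver X T), AlgPoints.map ψ' x =
      chartPoint 1 ![1, g (hφ.homeomorph.symm (AlgPoints.map ι x))] (by simp) := by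
    intro x
    apply Literature.AlgebraicGeometry.Motives.AlgPoints.map_injective (chartι 1 0)
    rw [← hψ x, AlgPoints.map_apply, AlgPoints.map_apply, AlgPoints.map_apply, Category.assoc, hψ'ι]
  -- the pulled-back coordinate `x₁/x₀`
  set c' : Γ((openOver X T).left, ⊤) := ψ'.left.appTop (coordSection 1 0 1) with hc'
  have hc'eval : ∀ x : ComplexPoints (openOver X T),
      evalOrZero ⊤ c' x = g (hφ.homeomorph.symm (AlgPoints.map ι x)) := by
    intro x
    have htop : (AlgPoints.map ψ' x).pt ∈ (⊤ : (chartScheme 1 0).left.Opens) := trivial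
    have h1 := AlgPoints.eval_map ψ' x ⊤ htop (coordSection 1 0 1)
    rw [AlgPoints.evalOrZero_of_mem c' (show x.pt ∈ (⊤ : (openOver X T).left.Opens) from trivial)]
    change x.eval (ψ'.left ⁻¹ᵁ ⊤) trivial (ψ'.left.app ⊤ (coordSection 1 0 1)) = _
    rw [← h1]
    have h2 : (AlgPoints.map ψ' x).eval ⊤ htop (coordSection 1 0 1) =
        (chartPoint 1 ![1, g (hφ.homeomorph.symm (AlgPoints.map ι x))] (by simp)).eval ⊤
          trivial (coordSection 1 0 1) := by
      congr 1
      exact hψ'pt x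
    rw [h2, eval_coordSection_chartPoint]
    simp
  -- transport `c'` to a section of `X` over `T`
  refine ⟨T.topIso.hom c', fun m hm ↦ ?_⟩
  have hmr : (φ m).pt ∈ ι.left.opensRange := by
    change (φ m).pt ∈ T.ι.opensRange
    rw [Scheme.Opens.opensRange_ι]
    exact hm
  set x := Literature.AlgebraicGeometry.Motives.AlgPoints.liftOfMemOpensRange ι (φ m) hmr with hx
  have hιx : AlgPoints.map ι x = φ m :=
    Literature.AlgebraicGeometry.Motives.AlgPoints.map_liftOfMemOpensRange ι (φ m) hmr
  have hmx : hφ.homeomorph.symm (AlgPoints.map ι x) = m := by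
    rw [hιx]
    exact hφ.homeomorph.symm_apply_apply m
  have hxT' : (AlgPoints.map ι x).pt ∈ T := by
    rw [hιx]
    exact hm
  have hxT : x.pt ∈ ι.left ⁻¹ᵁ T := hxT'
  -- evaluation at `φ m = ι(x)` is evaluation of `ι^* c` at `x`
  have hev : evalOrZero T (T.topIso.hom c') (AlgPoints.map ι x) =
      evalOrZero (ι.left ⁻¹ᵁ T) (ι.left.app T (T.topIso.hom c')) x := by
    rw [AlgPoints.evalOrZero_of_mem _ hxT', AlgPoints.eval_map ι x T hxT' (T.topIso.hom c'),
      ← AlgPoints.evalOrZero_of_mem _ hxT]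
  -- `ι^*` of the transported section is the restriction of `c'` from `⊤`
  have hsec : ι.left.app T (T.topIso.hom c') =
      (openOver X T).left.presheaf.map (homOfLE (le_top : ι.left ⁻¹ᵁ T ≤ ⊤)).op c' := by
    have hmor : T.topIso.hom ≫ T.ι.app T =
        (T : Scheme).presheaf.map (homOfLE (le_top : T.ι ⁻¹ᵁ T ≤ ⊤)).op := by
      rw [Scheme.Opens.topIso_hom, Scheme.Opens.ι_app, Scheme.Opens.toScheme_presheaf_map]
      change X.left.presheaf.map _ ≫ X.left.presheaf.map _ = X.left.presheaf.map _
      rw [← Functor.map_comp]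
      exact congrArg _ (Subsingleton.elim _ _)
    have h2 := ConcreteCategory.congr_hom hmor c'
    rw [ConcreteCategory.comp_apply] at h2
    exact h2
  rw [← hιx, hev, hsec, AlgPoints.evalOrZero_map_homOfLE (X := openOver X T) le_top c' hxT, hc'eval x, hmx]

/-! ### Regularity for the holomorphic-numerator form -/

/-- **A meromorphic function with holomorphic numerator and algebraic poles is regular** (Serre's Prop. 15,
holomorphe ⇒ régulière, in the form needed for GAGA-injectivity on `H¹(𝒪)`): `X` smooth projective over `ℂ` with
analytification `φ`, `T ⊆ X` open, `g : M → ℂ` locally `g · b(φ ·) = P` over `T` with `P` holomorphic and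
`T ∩ W = D(b)` ⇒ `g` is the analytification of a regular `c ∈ Γ(X, T)`: `c(φ m) = g m` whenever `φ m ∈ T(ℂ)`.
[cite: SerreGAGA1956, n° 19 Prop. 15 (pp. 29–30)] [cite: Mumford1981, §4B (4.14), p. 67] -/
theorem exists_section_eval_eq_of_holNumerator (hX : IsSmoothProjective n X)
    (hφ : IsAnalytification E X n φ) (T : X.left.Opens) (g : M → ℂ)
    (H : ∀ m : M, ∃ (W : X.left.Opens) (b : Γ(X.left, W)) (P : M → ℂ), (φ m).pt ∈ W ∧
      MDifferentiableOn 𝓘(ℂ, E) 𝓘(ℂ, ℂ) P (φ ⁻¹' {Q | Q.pt ∈ W}) ∧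
      ∀ m', (φ m').pt ∈ W →
        ((φ m').pt ∈ T ↔ evalOrZero W b (φ m') ≠ 0) ∧
        ((φ m').pt ∈ T → g m' * evalOrZero W b (φ m') = P m')) :
    ∃ c : Γ(X.left, T), ∀ m : M, (φ m).pt ∈ T → evalOrZero T c (φ m) = g m :=
  exists_section_eval_eq_of_isAnalyticSet_junkGraph hX hφ T g (isAnalyticSet_junkGraph_of_holNumerator hφ T g H)

/-- **A HOLOMORPHIC function over `T` with holomorphic-numerator / algebraic-denominator local forms near the
points OUTSIDE `T` is regular** — the form in which the hypothesis is met in practice: over `T` itself the local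
form is automatic (`W := T`, `b := 1`, `P := g`), so only the points of `X ∖ T` need a presentation
`g · b(φ ·) = P`, `T ∩ W = D(b)`. [cite: SerreGAGA1956, n° 19 Prop. 15 (pp. 29–30)] -/
theorem exists_section_eval_eq_of_mdifferentiableOn_of_holNumerator (hX : IsSmoothProjective n X)
    (hφ : IsAnalytification E X n φ) (T : X.left.Opens) (g : M → ℂ)
    (hg : MDifferentiableOn 𝓘(ℂ, E) 𝓘(ℂ, ℂ) g (φ ⁻¹' {Q | Q.pt ∈ T}))
    (H : ∀ m : M, (φ m).pt ∉ T → ∃ (W : X.left.Opens) (b : Γ(X.left, W)) (P : M → ℂ), (φ m).pt ∈ W ∧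
      MDifferentiableOn 𝓘(ℂ, E) 𝓘(ℂ, ℂ) P (φ ⁻¹' {Q | Q.pt ∈ W}) ∧
      ∀ m', (φ m').pt ∈ W →
        ((φ m').pt ∈ T ↔ evalOrZero W b (φ m') ≠ 0) ∧
        ((φ m').pt ∈ T → g m' * evalOrZero W b (φ m') = P m')) :
    ∃ c : Γ(X.left, T), ∀ m : M, (φ m).pt ∈ T → evalOrZero T c (φ m) = g m := by
  classical
  refine exists_section_eval_eq_of_holNumerator hX hφ T g fun m ↦ ?_
  by_cases hm : (φ m).pt ∈ T
  · -- over `T`: `W := T`, `b := 1`, `P := g`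
    have h1 : ∀ m', (φ m').pt ∈ T → evalOrZero T (1 : Γ(X.left, T)) (φ m') = 1 := fun m' hm' ↦ by
      rw [AlgPoints.evalOrZero_of_mem (1 : Γ(X.left, T)) hm']
      simp [AlgPoints.eval]
    refine ⟨T, 1, g, hm, hg, fun m' hm' ↦ ⟨?_, fun _ ↦ ?_⟩⟩
    · rw [h1 m' hm']
      exact ⟨fun _ ↦ one_ne_zero, fun _ ↦ hm'⟩
    · rw [h1 m' hm', mul_one]
  · exact H m hm


/-! ### GAGA-injectivity on `H¹(𝒪)`: a holomorphic coboundary of an algebraic Čech 1-cocycle is algebraic -/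

/-- **An algebraic Čech 1-cochain of `𝒪_X` that is a HOLOMORPHIC coboundary is an ALGEBRAIC coboundary
(cocycle-level GAGA-injectivity `Ȟ¹(𝔘, 𝒪_X) ↪ Ȟ¹(𝔘^an, 𝒪^an)`).** Let `X` be smooth projective over `ℂ` with
analytification `φ : M → X(ℂ)`, `U : ι → Opens X` an open cover such that each complement `X ∖ U_i` is LOCALLY
CUT OUT BY ONE EQUATION (`hU`: near every point an open `W` and `b ∈ Γ(X, W)` with `W ∩ U_i = D(b)` — e.g.
`U_i` the non-vanishing locus of a section of a line bundle, or the complement of the support of an effective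
Cartier divisor), `f_ij ∈ Γ(X, U_i ∩ U_j)` regular functions and `h_i : M → ℂ` HOLOMORPHIC on `φ⁻¹(U_i(ℂ))` with
`f_ij(φ m) = h_i m − h_j m` on `φ⁻¹((U_i ∩ U_j)(ℂ))`. Then every `h_i` is the analytification of a regular
`c_i ∈ Γ(X, U_i)`: `c_i(φ m) = h_i m` on `φ⁻¹(U_i(ℂ))` (so `(f_ij)` is the algebraic coboundary of `(c_i)` on complex
points). Proof: near a point of `U_j` outside `U_i`, with `W ∩ U_i = D(b)`, `W ⊆ U_j`, the regular function
`f_ij|_{D(b)}` is `y / b^N` for some `y ∈ Γ(X, W)` (Mathlib's qcqs lemma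
`exists_eq_pow_mul_of_isCompact_of_isQuasiSeparated` on the Noetherian `W`), so `h_i · b^{N+1} = h_j · b^{N+1} + y · b`
has HOLOMORPHIC NUMERATOR and algebraic denominator `b^{N+1}` with `D(b^{N+1}) = W ∩ U_i`; conclude by
`exists_section_eval_eq_of_mdifferentiableOn_of_holNumerator` (Serre's Prop. 15, holomorphe ⇒ régulière).
[cite: SerreGAGA1956, n° 12 Théorème 1 (p. 19) and n° 19 Prop. 15 (pp. 29–30)] [cite: Mumford1981, §4B (4.14), p. 67] -/
theorem exists_section_eval_eq_of_sub_eq_eval (hX : IsSmoothProjective n X)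
    (hφ : IsAnalytification E X n φ) {ι : Type*} (U : ι → X.left.Opens) (hcov : ∀ x : X.left, ∃ j, x ∈ U j)
    (hU : ∀ (i : ι) (x : X.left), ∃ (W : X.left.Opens) (b : Γ(X.left, W)), x ∈ W ∧ W ⊓ U i = X.left.basicOpen b)
    (h : ι → M → ℂ) (hh : ∀ i, MDifferentiableOn 𝓘(ℂ, E) 𝓘(ℂ, ℂ) (h i) (φ ⁻¹' {Q | Q.pt ∈ U i}))
    (f : ∀ i j, Γ(X.left, U i ⊓ U j))
    (hfh : ∀ (i j : ι) (m : M), (φ m).pt ∈ U i ⊓ U j →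
      evalOrZero (U i ⊓ U j) (f i j) (φ m) = h i m - h j m)
    (i : ι) : ∃ c : Γ(X.left, U i), ∀ m : M, (φ m).pt ∈ U i → evalOrZero (U i) c (φ m) = h i m := by
  classical
  -- `X` is a Noetherian scheme: every open is compact and quasi-separated
  haveI : SmoothOfRelativeDimension n X.hom := hX.smoothOfRelativeDimension
  haveI : Smooth X.hom := SmoothOfRelativeDimension.smooth n X.hom
  haveI : LocallyOfFiniteType X.hom := inferInstance
  haveI : IsProper X.hom := IsSmoothProjective.isProper_holds hX
  haveI : IsLocallyNoetherian X.left := LocallyOfFiniteType.isLocallyNoetherian X.hom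
  haveI : CompactSpace X.left := (quasiCompact_iff_compactSpace X.hom).mp inferInstance
  haveI : IsNoetherian X.left := { }
  have hcpt : ∀ s : Set X.left, IsCompact s := fun s ↦ TopologicalSpace.NoetherianSpace.isCompact s
  have hqs : ∀ s : Set X.left, IsQuasiSeparated s := fun s U V _ _ _ _ _ _ ↦ hcpt _
  -- evaluation at a complex point is multiplicative / additive
  have heval_mul : ∀ (O : X.left.Opens) (s t : Γ(X.left, O)) (Q : ComplexPoints X) (hQ : Q.pt ∈ O),
      Q.eval O hQ (s * t) = Q.eval O hQ s * Q.eval O hQ t := fun O s t Q hQ ↦ by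
    simp only [AlgPoints.eval, map_mul]
  have heval_pow : ∀ (O : X.left.Opens) (s : Γ(X.left, O)) (k : ℕ) (Q : ComplexPoints X) (hQ : Q.pt ∈ O),
      Q.eval O hQ (s ^ k) = Q.eval O hQ s ^ k := fun O s k Q hQ ↦ by
    simp only [AlgPoints.eval, map_pow]
  refine exists_section_eval_eq_of_mdifferentiableOn_of_holNumerator hX hφ (U i) (h i) (hh i) fun m hm ↦ ?_
  obtain ⟨j, hj⟩ := hcov (φ m).pt
  obtain ⟨W, b, hxW, hWb⟩ := hU i (φ m).pt
  -- shrink to `W' := W ∩ U_j`, where `h_j` is holomorphic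
  set W' : X.left.Opens := W ⊓ U j with hW'
  have hW'W : W' ≤ W := inf_le_left
  have hW'j : W' ≤ U j := inf_le_right
  set b' : Γ(X.left, W') := X.left.presheaf.map (homOfLE hW'W).op b with hb'def
  have hb' : X.left.basicOpen b' = W' ⊓ U i := by
    rw [hb'def, Scheme.basicOpen_res, ← hWb]
    ext x
    simp only [TopologicalSpace.Opens.coe_inf, Set.mem_inter_iff, hW', TopologicalSpace.Opens.coe_inf]
    tauto
  have hVij : X.left.basicOpen b' ≤ U i ⊓ U j := by
    rw [hb']
    exact inf_le_inf_right _ hW'j |>.trans (by rw [inf_comm])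
  have hVW' : X.left.basicOpen b' ≤ W' := X.left.basicOpen_le b'
  -- `f_ij|_{D(b')} = y / b'^N` with `y ∈ Γ(X, W')` (qcqs lemma on the Noetherian open `W'`)
  set x : Γ(X.left, X.left.basicOpen b') := X.left.presheaf.map (homOfLE hVij).op (f i j) with hxdef
  obtain ⟨N, y, hy⟩ := exists_eq_pow_mul_of_isCompact_of_isQuasiSeparated X.left W' (hcpt _) (hqs _) b' x
  have hy' : X.left.presheaf.map (homOfLE hVW').op y =
      (X.left.presheaf.map (homOfLE hVW').op b') ^ N * x := hy
  -- the holomorphic numerator `P := h_j · b'^{N+1} + y · b'` on `φ⁻¹(W'(ℂ))`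
  have hPb : MDifferentiableOn 𝓘(ℂ, E) 𝓘(ℂ, ℂ) (fun m' ↦ evalOrZero W' b' (φ m')) (φ ⁻¹' {Q | Q.pt ∈ W'}) :=
    IsAnalytification.mdifferentiableOn_evalOrZero_opens_holds hφ W' b'
  have hPy : MDifferentiableOn 𝓘(ℂ, E) 𝓘(ℂ, ℂ) (fun m' ↦ evalOrZero W' y (φ m')) (φ ⁻¹' {Q | Q.pt ∈ W'}) :=
    IsAnalytification.mdifferentiableOn_evalOrZero_opens_holds hφ W' y
  have hPj : MDifferentiableOn 𝓘(ℂ, E) 𝓘(ℂ, ℂ) (h j) (φ ⁻¹' {Q | Q.pt ∈ W'}) :=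
    (hh j).mono fun m' (hm' : (φ m').pt ∈ W') ↦ hW'j hm'
  refine ⟨W', b' ^ (N + 1),
    fun m' ↦ h j m' * evalOrZero W' b' (φ m') ^ (N + 1) + evalOrZero W' y (φ m') * evalOrZero W' b' (φ m'),
    ⟨hxW, hj⟩, (hPj.mul (hPb.pow _)).add (hPy.mul hPb), fun m' hm' ↦ ⟨?_, fun hT ↦ ?_⟩⟩
  · -- `(φ m').pt ∈ U_i ↔ b'^{N+1}(φ m') ≠ 0`
    rw [AlgPoints.evalOrZero_of_mem _ hm', heval_pow, pow_ne_zero_iff (Nat.succ_ne_zero N),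
      AlgPoints.eval_ne_zero_iff_mem_basicOpen, hb']
    exact ⟨fun h ↦ ⟨hm', h⟩, fun h ↦ h.2⟩
  · -- `h_i(m') · b'^{N+1} = h_j(m') · b'^{N+1} + y · b'` over `U_i`
    have hm'V : (φ m').pt ∈ X.left.basicOpen b' := by
      rw [hb']
      exact ⟨hm', hT⟩
    have hfij := hfh i j m' (hVij hm'V)
    -- evaluate the identity `y|_V = b'|_V ^ N · x` at `φ m'`
    have hyev : evalOrZero W' y (φ m') = evalOrZero W' b' (φ m') ^ N * (h i m' - h j m') := by
      have h1 := congrArg (fun s ↦ (φ m').eval (X.left.basicOpen b') hm'V s) hy'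
      simp only [heval_mul, heval_pow] at h1
      rw [← AlgPoints.evalOrZero_of_mem _ hm'V, ← AlgPoints.evalOrZero_of_mem _ hm'V,
        ← AlgPoints.evalOrZero_of_mem _ hm'V, AlgPoints.evalOrZero_map_homOfLE hVW' y hm'V,
        AlgPoints.evalOrZero_map_homOfLE hVW' b' hm'V, hxdef,
        AlgPoints.evalOrZero_map_homOfLE hVij (f i j) hm'V, hfij] at h1
      exact h1
    beta_reduce
    rw [AlgPoints.evalOrZero_of_mem _ hm', heval_pow, ← AlgPoints.evalOrZero_of_mem _ hm', hyev]
    ring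

end Main

end Literature.AlgebraicGeometry.HodgeTheory

end
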